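import Mathlib
import Literature.NumberTheory.Transcendental.KZHyperbolicLadder
import Literature.NumberTheory.Transcendental.KZCalculusProofs
import Literature.NumberTheory.Transcendental.KZLogCalculusProofs
import Literature.NumberTheory.Transcendental.KZIdealTetrahedron
import Summits.KontsevichZagierPeriods.KontsevichZagierPeriods.Theorems.HyperbolicBlochOffTetraSectorKernelTetraIsPolytope
import Summits.KontsevichZagierPeriods.KontsevichZagierPeriods.Theorems.HyperbolicBlochOffTetraSectorKernelLadderFamilyExists

/-!
# `OffTetraSectorKernel` (stmt-KontsevichZagierPeriods-10557), line `odd-hyperbolic-ladder`: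
# the tetrahedral value-relators are rung-`2` value-relators modulo the moves

Stub `tetraRelators_subset_relations_sup_rungTwo`. The crux adjoins to Kontsevich–Zagier's
relations the TETRAHEDRAL value-relators `Σ nᵢ • [ρ (zᵢ)]` of an admissible family `ρ` on the
pinned ideal tetrahedra `T z = idealTetrahedron z` (`z ∈ ℚ̄`, `Im z > 0`, integrand `t⁻³`,
`Σ nᵢ · vol T(zᵢ) = 0`). Rung `2` of Goncharov's hyperbolic scissors ladder
(`KZ.rungRelators 2`) consists of the value-relators `Σ mᵢ • [ρ₂ (Pᵢ)]` of an admissible LADDER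
family `ρ₂` (`KZ.IsLadderFamily 2 ρ₂`: domain `P`, integrand `KZ.hypDensity 2 = t⁻³` on every
rung-`2` polytope `P`) with `Σ mᵢ · vol Pᵢ = 0`. Since the ideal tetrahedra ARE rung-`2`
polytopes (`idealTetrahedron_isGeodesicPolytope`) and a ladder family exists
(`exists_isLadderFamily`), the two representations `ρ (z)` and `ρ₂ (T z)` have the same domain
and integrands agreeing on it, hence differ by a relation (`KZ.of_sub_of_mem_relations_of_eqOn`)
and have the same value (`KZ.Equivalent.value_eq_holds`); exchanging generators puts every
tetrahedral value-relator in `KZ.relations ⊔ closure (KZ.rungRelators 2)`.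

References: M. Kontsevich, D. Zagier, *Periods* (2001), §1.2; A. B. Goncharov, *Volumes of
hyperbolic manifolds and mixed Tate motives* (1999), §1.7.
-/

noncomputable section

open Set MeasureTheory
open Literature.NumberTheory.Transcendental

namespace Summit.KontsevichZagierPeriods.HyperbolicBloch.OffTetraSectorKernel

/-- The rung-`2` density `KZ.hypDensity 2` is `t⁻³ = 1 / p 2 ^ 3` on `Fin 3 → ℝ`. [folklore] -/
theorem tetraRung_hypDensity_two (p : Fin 3 → ℝ) : KZ.hypDensity 2 p = 1 / p 2 ^ 3 := rfl

/-- **Generatorwise exchange.** An admissible tetrahedral representation `ρ z` on the pinned solid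
`T z = idealTetrahedron z` (`z` algebraic, `Im z > 0`) and the representation `ρ₂ (T z)` of an
admissible rung-`2` ladder family differ by a Kontsevich–Zagier relation: same domain `T z`
(a rung-`2` polytope), integrands both equal to `t⁻³` on it. [cite: KontsevichZagier2001, §1.2] -/
theorem tetraRung_of_sub_of_mem_relations {ρ : ℂ → KZ.IntegralRep 3}
    {ρ₂ : Set (Fin 3 → ℝ) → KZ.IntegralRep 3}
    (hρ : ∀ z, IsAlgebraic ℚ z → 0 < z.im → (ρ z).domain = idealTetrahedron z ∧
      EqOn (ρ z).integrand (fun p => 1 / p 2 ^ 3) (idealTetrahedron z))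
    (hρ₂ : KZ.IsLadderFamily 2 ρ₂) {z : ℂ} (hz : IsAlgebraic ℚ z) (him : 0 < z.im) :
    KZ.of (ρ z) - KZ.of (ρ₂ (idealTetrahedron z)) ∈ KZ.relations := by
  obtain ⟨hdom, heq⟩ := hρ z hz him
  obtain ⟨hdom₂, heq₂⟩ := hρ₂ (idealTetrahedron z) (idealTetrahedron_isGeodesicPolytope z hz him)
  refine KZ.of_sub_of_mem_relations_of_eqOn (hdom₂.trans hdom.symm) ?_
  rw [hdom]
  intro p hp
  rw [heq hp, heq₂ hp, tetraRung_hypDensity_two]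

/-- **The tetrahedral value-relators are rung-`2` value-relators modulo the moves.** For the
pinned family of ideal tetrahedra `T z` (`= idealTetrahedron z`), every tetrahedral value-relator
`Σ nᵢ • [ρ (zᵢ)]` (`ρ` admissible on `T`, `zᵢ ∈ ℚ̄`, `Im zᵢ > 0`, `Σ nᵢ · value = 0`) lies in
`KZ.relations ⊔ closure (KZ.rungRelators 2)`: exchange each `[ρ (zᵢ)]` for `[ρ₂ (T zᵢ)]`
(`ρ₂` an admissible ladder family, `exists_isLadderFamily 2`; the `T zᵢ` are rung-`2` polytopes,
`idealTetrahedron_isGeodesicPolytope`) at the cost of a relation, the values being unchanged.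
[cite: Goncharov1999, §1.7] -/
theorem tetraRelators_subset_relations_sup_rungTwo : ∀ (T : ℂ → Set (Fin 3 → ℝ)), (∀ z, T z = {p | 0 < p 1 ∧ z.re * p 1 < z.im * p 0 ∧ z.im * (p 0 - 1) < (z.re - 1) * p 1 ∧ 0 < p 2 ∧ 0 < z.im * (p 0 ^ 2 + p 1 ^ 2 + p 2 ^ 2 - p 0) + (z.re - Complex.normSq z) * p 1}) → ∀ d ∈ {d : Literature.NumberTheory.Transcendental.KZ.FormalRep | ∃ ρ : ℂ → Literature.NumberTheory.Transcendental.KZ.IntegralRep 3, (∀ z, IsAlgebraic ℚ z → 0 < z.im → (ρ z).domain = T z ∧ Set.EqOn (ρ z).integrand (fun p => 1 / p 2 ^ 3) (T z)) ∧ ∃ (k : ℕ) (z : Fin k → ℂ) (n : Fin k → ℤ), (∀ i, IsAlgebraic ℚ (z i)) ∧ (∀ i, 0 < (z i).im) ∧ ∑ i, (n i : ℝ) * (ρ (z i)).value = 0 ∧ d = ∑ i, n i • Literature.NumberTheory.Transcendental.KZ.of (ρ (z i))}, d ∈ Literature.NumberTheory.Transcendental.KZ.relations ⊔ AddSubgroup.closure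 (Literature.NumberTheory.Transcendental.KZ.rungRelators 2) := by
  intro T hT d hd
  have hTe : T = idealTetrahedron := funext fun z => (hT z).trans rfl
  subst hTe
  obtain ⟨ρ, hρ, k, z, n, halg, him, hsum, rfl⟩ := hd
  obtain ⟨ρ₂, hρ₂⟩ := exists_isLadderFamily 2
  -- generatorwise exchange `[ρ (z i)] ≡ [ρ₂ (T (z i))]` modulo relations, values unchanged
  have hdiff : ∀ i, KZ.of (ρ (z i)) - KZ.of (ρ₂ (idealTetrahedron (z i))) ∈ KZ.relations :=
    fun i => tetraRung_of_sub_of_mem_relations hρ hρ₂ (halg i) (him i)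
  have hval : ∀ i, (ρ₂ (idealTetrahedron (z i))).value = (ρ (z i)).value := fun i =>
    (KZ.Equivalent.value_eq_holds (hdiff i)).symm
  have hsum₂ : ∑ i, (n i : ℝ) * (ρ₂ (idealTetrahedron (z i))).value = 0 := by
    simpa only [hval] using hsum
  -- the exchanged combination is a rung-`2` value-relator
  have hmem : ∑ i, n i • KZ.of (ρ₂ (idealTetrahedron (z i))) ∈ KZ.rungRelators 2 :=
    ⟨ρ₂, hρ₂, k, fun i => idealTetrahedron (z i), n,
      fun i => idealTetrahedron_isGeodesicPolytope (z i) (halg i) (him i), hsum₂, rfl⟩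
  have hsplit : ∑ i, n i • KZ.of (ρ (z i)) =
      (∑ i, n i • KZ.of (ρ (z i)) - ∑ i, n i • KZ.of (ρ₂ (idealTetrahedron (z i)))) +
        ∑ i, n i • KZ.of (ρ₂ (idealTetrahedron (z i))) := by
    abel
  rw [hsplit]
  refine add_mem (AddSubgroup.mem_sup_left ?_)
    (AddSubgroup.mem_sup_right (AddSubgroup.subset_closure hmem))
  rw [← Finset.sum_sub_distrib]
  refine sum_mem fun i _ => ?_
  rw [← smul_sub]
  exact zsmul_mem (hdiff i) _

end Summit.KontsevichZagierPeriods.HyperbolicBloch.OffTetraSectorKernel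

end
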